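import Mathlib
import Literature.NumberTheory.LFunctions.Zhang2022.SkeletonEval97cL102Rel
import Literature.NumberTheory.LFunctions.Zhang2022.Section18DefsE
import HarnessLib

/-!
# Zhang (2022), typed skeleton — the §15–§18 evaluation chain PARAMETRISED over `e″_{1j}` (RT-05)

Topic `Literature/NumberTheory/LFunctions/Zhang2022` (Landau–Siegel audit tree; verdict-neutral).
Y. Zhang, *Discrete mean estimates and the Landau–Siegel zero*, arXiv:2211.02515v1 (2022)
[Zhang2022LandauSiegel] — **an unrefereed manuscript under adjudication. Nothing in this file asserts
that any hypothesis below holds; every `def … : Prop` is a CLAIM of the manuscript (or a reading of one),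
STATED NOT ASSERTED.**

This is the companion of `SkeletonEvalRel` / `SkeletonEval97cL102Rel` demanded by the ZHANG-L lane's
re-type RT-05 («e″₁ⱼ-fork», zl-lead rulings R-22/R-28, referee of record zl-ref-chief C1–C5): the four
evaluation nodes of §§15–18 that name the constants `𝔢ⱼ` / `𝔠₃` and the §18 margin are re-stated with
the value of Lemma 15.1's `e″_{1j}` a PARAMETER `e1pp : ℕ → ℂ` (through `frakeE e1pp`, `frakc3E e1pp` of
`Section18DefsE`, zl-w15-typer p476083), and the three constant-AGNOSTIC edges of the §2 p. 6 endgame are re-proved verbatim at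
the parameter:

* nodes `Eval1524RelE e1pp c′` ((15.24)ᴿ), `Eval1617RelE` ((16.17)ᴿ), `Eval1710RelE` ((17.10)ᴿ),
  `Eval181RelE` ((18.1)ᴿ), `Margin232WithE e1pp k` (the §18 margin `𝔠₁ + k + 2(Re 𝔠₃ + 10⁻⁵) < 0.001`
  with `𝔠₃ := frakc3E e1pp`);
* `Iff.rfl` bridges at `e1pp := e1ppj` (the STATED value) to the banked nodes `Eval1524Rel` … `Eval181Rel`,
  `Margin232With` — so nothing banked is re-typed, the banked chain is the `e1ppj` instance of this one;
* (in the companion PROOF file `SkeletonEvalRelEEdges`) the edges `eval181RelE_of_parts`,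
  `ineq232E_of_evals_with`, `theorem1E_of_evaluations_with` — copies of the banked constant-agnostic proofs
  with `frake ↦ frakeE e1pp`, `frakc3 ↦ frakc3E e1pp`; this file is STATEMENT-ONLY (defs + `Iff.rfl`);
* for the record (NOT used by any chain, and filed separately in `SkeletonEvalRelERefuted` so that this
  file does not import the numerics): at the DERIVED value `e1pp := AppendixB.e1ppD` (reading of record
  D-G-num2-1) the margin is refuted exactly as at the stated one (zl-w15-ref-1's certified
  `not_margin232D_with_of_le`, `Section18Margin232D` p475116, through `frakc3D_eq_frakc3E_e1ppD`).

The whole-DAG re-threads `SkeletonWholeDAGvN` (N ≥ 24) carry the §15/§16/§17 𝔢-leaves at `frakeE e1ppD`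
and conclude Theorem 1 through `theorem1E_of_evaluations_with e1ppD` with the ONE permitted hypothesis
`Margin232WithE e1ppD frakc2c.re` (documentary — refuted); the margin-free companion `sec2_inputs…`
carries `Eval181RelE e1ppD c′`.

What is NOT asserted: any node; Theorem 1; anything about which value of `e″_{1j}` is right; anything
about Landau–Siegel zeros.

## References

* Y. Zhang, arXiv:2211.02515v1 (2022): Lemma 15.1 p. 80, (15.24) p. 88, (16.17) p. 95, (17.10) p. 99,
  (18.1) p. 99 and §18 p. 99–100 (the deduction of (2.32)), §2 p. 6, Appendix B (B.3) p. 110.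
  [cite: Zhang2022LandauSiegel, §18 (18.1)]
-/

noncomputable section

open Complex Real

namespace Literature.NumberTheory.LFunctions.Zhang2022.Skeleton

/-! ## The evaluation nodes at a parameter value of `e″_{1j}` -/

section Nodes

variable (e1pp : ℕ → ℂ) (c' : ℝ)

/-- **(15.24), relative, 𝔢 parametrised**: `‖Φ₁ − (𝔢₁+2𝔢₂+𝔢₃)𝔞𝔓‖ ≤ ε(𝔞+1)𝔓` eventually, with
`𝔢ⱼ := frakeE e1pp j`. CLAIM (reading). [cite: Zhang2022LandauSiegel, §15 (15.24)] -/
def Eval1524RelE : Prop :=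
  ∀ ε : ℝ, 0 < ε → ForAllLarge fun D _ χ => AssumptionA D χ →
    ‖Phi1 c' χ - (frakeE e1pp 1 + 2 * frakeE e1pp 2 + frakeE e1pp 3) * frakA χ * frakP D‖ ≤
      ε * (frakA χ + 1) * frakP D

/-- **(16.17), relative, 𝔢 parametrised**: `‖Φ₂ − (𝔢₁+𝔢₂)𝔞𝔓‖ ≤ ε(𝔞+1)𝔓` eventually. CLAIM (reading).
[cite: Zhang2022LandauSiegel, §16 (16.17)] -/
def Eval1617RelE : Prop :=
  ∀ ε : ℝ, 0 < ε → ForAllLarge fun D _ χ => AssumptionA D χ →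
    ‖Phi2 c' χ - (frakeE e1pp 1 + frakeE e1pp 2) * frakA χ * frakP D‖ ≤ ε * (frakA χ + 1) * frakP D

/-- **(17.10), relative, 𝔢 parametrised**: `‖Φ₃ + (𝔢₀+𝔢₁)𝔞𝔓‖ ≤ ε(𝔞+1)𝔓` eventually. CLAIM (reading).
[cite: Zhang2022LandauSiegel, §17 (17.10)] -/
def Eval1710RelE : Prop :=
  ∀ ε : ℝ, 0 < ε → ForAllLarge fun D _ χ => AssumptionA D χ →
    ‖Phi3 c' χ + (frake0 + frakeE e1pp 1) * frakA χ * frakP D‖ ≤ ε * (frakA χ + 1) * frakP D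

/-- **(18.1), relative, 𝔠₃ parametrised**: `‖Ξ₁₃ − 𝔠₃𝔞𝔓‖ ≤ 10⁻⁵𝔞𝔓 + ε(𝔞+1)𝔓` eventually, with
`𝔠₃ := frakc3E e1pp`. CLAIM (reading). [cite: Zhang2022LandauSiegel, §18 (18.1)] -/
def Eval181RelE : Prop :=
  ∀ ε : ℝ, 0 < ε → ForAllLarge fun D _ χ => AssumptionA D χ →
    ‖xi13 c' χ - frakc3E e1pp * frakA χ * frakP D‖ ≤
      1e-5 * frakA χ * frakP D + ε * (frakA χ + 1) * frakP D

/-- **The §18 margin with `𝔠₂ := k` and `𝔠₃ := frakc3E e1pp`**: `𝔠₁ + k + 2(Re 𝔠₃ + 10⁻⁵) < 0.001`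
(`Margin232With k` is the `e1ppj` instance; at `e1ppD` it is refuted for every `k ≥ frakc2c.re`,
`Section18Margin232D.not_margin232D_with_of_le` via `frakc3D_eq_frakc3E_e1ppD`). CLAIM — the failing inequality of §18 p. 36 in the given reading.
[cite: Zhang2022LandauSiegel, §18 p. 36] -/
def Margin232WithE (k : ℝ) : Prop := frakc1.re + k + 2 * ((frakc3E e1pp).re + 1e-5) < 0.001

end Nodes

/-! ## The banked nodes are the `e1ppj` instances (definitional) -/

section Bridges

variable (c' : ℝ)

/-- `Eval1524RelE e1ppj` IS the banked `Eval1524Rel`. [cite: Zhang2022LandauSiegel, §15 (15.24)] -/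
theorem eval1524RelE_e1ppj_iff : Eval1524RelE e1ppj c' ↔ Eval1524Rel c' := Iff.rfl

/-- `Eval1617RelE e1ppj` IS the banked `Eval1617Rel`. [cite: Zhang2022LandauSiegel, §16 (16.17)] -/
theorem eval1617RelE_e1ppj_iff : Eval1617RelE e1ppj c' ↔ Eval1617Rel c' := Iff.rfl

/-- `Eval1710RelE e1ppj` IS the banked `Eval1710Rel`. [cite: Zhang2022LandauSiegel, §17 (17.10)] -/
theorem eval1710RelE_e1ppj_iff : Eval1710RelE e1ppj c' ↔ Eval1710Rel c' := Iff.rfl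

/-- `Eval181RelE e1ppj` IS the banked `Eval181Rel`. [cite: Zhang2022LandauSiegel, §18 (18.1)] -/
theorem eval181RelE_e1ppj_iff : Eval181RelE e1ppj c' ↔ Eval181Rel c' := Iff.rfl

/-- `Margin232WithE e1ppj k` IS the banked `Margin232With k`. [cite: Zhang2022LandauSiegel, §18 p. 36] -/
theorem margin232WithE_e1ppj_iff (k : ℝ) : Margin232WithE e1ppj k ↔ Margin232With k := Iff.rfl

end Bridges

end Literature.NumberTheory.LFunctions.Zhang2022.Skeleton
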